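import Mathlib
import Literature.Computability.AlgebraicComplexity.KroneckerRank
import Literature.Computability.AlgebraicComplexity.TensorMultiples

/-!
# Kronecker ladder of clock-and-shift cocycle completions — stub `stub_kroneckerLadder` of line
`registered` (crux `Thesis`, stmt-MatrixMultiplication-5491)

Route `WindowedCompletionRank` writes `n × n` matrix multiplication, `n = m^k`, in the
clock-and-shift (Weyl) basis of `M_n`, indexed by
`G_k = (ℤ_m^k)² = (Fin k → ZMod m) × (Fin k → ZMod m)`; the structure constants are the 2-cocycle
`ζ_m^{g₂·h₁} = exp (2πi (Σ_i g.2 i * h.1 i).val / m)`. A *completion* is any tensor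
`S : G_k → G_k → G_k → ℂ` agreeing with the cocycle on the addition graph `{(g+h, g, h)}`.

**Kronecker ladder.** A completion at level `(m, k)` of tensor rank `≤ c` gives, for every `j`, a
completion at level `(m, j*k)` of rank `≤ c^j`: take the `j`-th Kronecker power `S^{⊗j}`
(`kroneckerPow`) and transport it along the block re-indexing `G_{jk} ≃ (Fin j → G_k)` induced
by `finProdFinEquiv : Fin j × Fin k ≃ Fin (j * k)` (block `t`, position `i`). The rank bound is
Bläser 2013, Lemma 5.8 iterated (`tensorRank_kroneckerPow_le`) plus invariance under
relabelling (`tensorRank_reindex`); the cocycle identity holds because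
`v ↦ exp (2πi v.val / m)` is the standard additive character of `ZMod m` (`ZMod.toCircle`), so it
turns the block sum `Σ_t Σ_i` of the exponent into a product over blocks.
-/

set_option linter.dupNamespace false
-- (single-conjunct summit: the namespace repeats `MatrixMultiplication`)

namespace Summit.MatrixMultiplication.MatrixMultiplication.Theorems.Thesis

open Literature.Computability.AlgebraicComplexity

/-- The clock phase `v ↦ exp (2πi v.val / m)` of `ZMod m` turns finite sums into products (it is
the standard additive character `ZMod.toCircle`). -/
theorem exp_val_sum_eq_prod (m : ℕ) [NeZero m] {ι : Type*} (s : Finset ι) (x : ι → ZMod m) :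
    Complex.exp (2 * Real.pi * Complex.I * ((∑ t ∈ s, x t).val : ℂ) / m) =
      ∏ t ∈ s, Complex.exp (2 * Real.pi * Complex.I * ((x t).val : ℂ) / m) := by
  simp only [← ZMod.toCircle_apply]
  induction s using Finset.cons_induction with
  | empty => simp
  | cons a s ha ih =>
    rw [Finset.sum_cons, Finset.prod_cons, AddChar.map_add_eq_mul, Circle.coe_mul, ih]

/-- **Kronecker ladder** (registered stub `stub_kroneckerLadder` of line `registered`, crux
`Thesis`): a completion `S` of the clock-and-shift cocycle `ζ_m^{g₂·h₁}` on `((ℤ_m^k)²)³` with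
`R(S) ≤ c` yields, for every `j`, a completion of the cocycle on `((ℤ_m^{jk})²)³` with
`R ≤ c^j` — the `j`-th Kronecker power re-indexed along `Fin (j*k) ≃ Fin j × Fin k`; the
cocycle is multiplicative over blocks (`exp_val_sum_eq_prod`), the rank bound is Bläser 2013,
Lemma 5.8 iterated (`tensorRank_kroneckerPow_le`, `tensorRank_reindex`).
[cite: Blaser2013, Lemma 5.8] -/
theorem stub_kroneckerLadder :
    ∀ (m k c : ℕ), 2 ≤ m →
      (∃ S : ((Fin k → ZMod m) × (Fin k → ZMod m)) → ((Fin k → ZMod m) × (Fin k → ZMod m)) →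
          ((Fin k → ZMod m) × (Fin k → ZMod m)) → ℂ,
        (∀ g h : (Fin k → ZMod m) × (Fin k → ZMod m),
          S (g + h) g h = Complex.exp (2 * Real.pi * Complex.I * ((∑ i, g.2 i * h.1 i).val : ℂ) / m)) ∧
        Literature.Computability.AlgebraicComplexity.tensorRank S ≤ c) →
      ∀ j : ℕ,
        ∃ S : ((Fin (j * k) → ZMod m) × (Fin (j * k) → ZMod m)) →
            ((Fin (j * k) → ZMod m) × (Fin (j * k) → ZMod m)) →
            ((Fin (j * k) → ZMod m) × (Fin (j * k) → ZMod m)) → ℂ,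
          (∀ g h : (Fin (j * k) → ZMod m) × (Fin (j * k) → ZMod m),
            S (g + h) g h = Complex.exp (2 * Real.pi * Complex.I * ((∑ i, g.2 i * h.1 i).val : ℂ) / m)) ∧
          Literature.Computability.AlgebraicComplexity.tensorRank S ≤ c ^ j := by
  intro m k c hm hyp j
  obtain ⟨S₀, hS₀, hrank⟩ := hyp
  haveI : NeZero m := ⟨by omega⟩
  -- block re-indexing `G_{jk} ≃ (Fin j → G_k)` along `finProdFinEquiv` (block `t`, position `i`):
  -- additive, with its two defining projection formulas
  obtain ⟨e, he_add, he₁, he₂⟩ :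
      ∃ e : ((Fin (j * k) → ZMod m) × (Fin (j * k) → ZMod m)) ≃
          (Fin j → (Fin k → ZMod m) × (Fin k → ZMod m)),
        (∀ g h, e (g + h) = e g + e h) ∧
        (∀ g t i, (e g t).1 i = g.1 (finProdFinEquiv (t, i))) ∧
        (∀ g t i, (e g t).2 i = g.2 (finProdFinEquiv (t, i))) :=
    ⟨{ toFun := fun g t =>
          (fun i => g.1 (finProdFinEquiv (t, i)), fun i => g.2 (finProdFinEquiv (t, i)))
       invFun := fun f =>
          (fun n => (f (finProdFinEquiv.symm n).1).1 (finProdFinEquiv.symm n).2,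
            fun n => (f (finProdFinEquiv.symm n).1).2 (finProdFinEquiv.symm n).2)
       left_inv := fun g => by
         ext n <;> simp only [Prod.mk.eta, Equiv.apply_symm_apply]
       right_inv := fun f => by
         funext t
         ext i <;> simp only [Equiv.symm_apply_apply] },
      fun _ _ => rfl, fun _ _ _ => rfl, fun _ _ _ => rfl⟩
  refine ⟨fun a b d => kroneckerPow S₀ j (e a) (e b) (e d), fun g h => ?_, ?_⟩
  · -- cocycle: the exponent is the block sum of the level-`k` exponents, the phase is additive,
    -- and each block factor is the level-`k` cocycle identity for `S₀`
    have hsum : (∑ n, g.2 n * h.1 n) = ∑ t, ∑ i, (e g t).2 i * (e h t).1 i := by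
      rw [← Equiv.sum_comp finProdFinEquiv (fun n => g.2 n * h.1 n), Fintype.sum_prod_type]
      simp only [he₁, he₂]
    beta_reduce
    rw [kroneckerPow_apply, he_add, hsum, exp_val_sum_eq_prod]
    refine Finset.prod_congr rfl fun t _ => ?_
    rw [Pi.add_apply, hS₀]
  · -- rank: relabelling invariance, then `R(S₀^{⊗j}) ≤ R(S₀)^j ≤ c^j`
    rw [tensorRank_reindex e e e (kroneckerPow S₀ j)]
    exact (tensorRank_kroneckerPow_le S₀ j).trans (Nat.pow_le_pow_left hrank j)

end Summit.MatrixMultiplication.MatrixMultiplication.Theorems.Thesis
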